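import Mathlib
import Literature.Analysis.FluidPDE.TypeIAncientMild
import Literature.Analysis.FluidPDE.NSLocalLerayBackwardUniqueness
import Literature.Analysis.FluidPDE.BarkerPrange2020VorticityAlignmentTypeIHolds
import Summits.NavierStokesRegularity.NavierStokesRegularity.Theorems.ClockStretchingLawClockCeilingOpenSetVorticityLiouville
import HarnessLib

/-!
# Census block A2 (amplitude / pointwise meters), cells A2jv / A2ju / A2jp / A2jt (DECIDED), A2jN / A2jNU / A2jT (OPEN) — instrument «JET METER», LINE «jet-meter» port
# (one file): §A flat jets of analytic maps, §B the instrument (jets at one point), §C space jets on the class, §D time jets on the class, §E the rows, §F verdicts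
# and nestings; census KEYS `Row_A2jv` / `Row_A2ju` / `Row_A2jp` / `Row_A2jt` + `_excluded`, `Row_A2jN` / `Row_A2jNU` / `Row_A2jT` (OPEN)

Re-homed for the scenario census (typer seat ns-census-typer-1 g9; the cells A2jv / A2ju / A2jp / A2jt are MEMBERS OF RECORD «DECIDED IN KERNEL IN FILES» of
block A2 since census v1.87 (critic idea-crit-3 PASS 06:01Z; ref ns-census-ref g11 PRE-CHECK ✓ §16.18 item 55; lead-presearch label); this port makes them
TREE-decided): VERBATIM PORT of ns-idea-2 LINE g15-4 «jet-meter», `pub/ideators/ns-idea-2/lines/jet-meter/line-jet-meter.lean` sha16 79ebe1bc37a2c26c (295 l.,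
lean check rc 0, 0 sorry), one tree file (§A–§F + census KEYS).  Lean text VERBATIM in namespace `…Theorems.ScenarioCensus.JetMeter` (the line's `…Lines.JetMeter`
re-homed); port edits: `local notation "E3"` → `abbrev E3` (typer lint: no notation in port files), `@[conjecture]` on the OPEN rows `Row_A2jN` / `Row_A2jNU` /
`Row_A2jT` (typed only), five one-line docstrings added (gate lint).  Statements untouched.

No census VALUE is moved here (the cells become TREE-decided by name; booking is the lead's); NS regularity is NOT proved; (L′) ⟨10661⟩ is untouched; no
summit statement is proved by this file.
-/

-- the summit and its single problem share the name `NavierStokesRegularity` (D-0017 nested layout)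
set_option linter.dupNamespace false

noncomputable section

open Set Function Filter Topology Metric MeasureTheory
open scoped RealInnerProductSpace ENNReal NNReal Nat

namespace Summit.NavierStokesRegularity.NavierStokesRegularity.Theorems.ScenarioCensus.JetMeter

open Literature.Analysis Literature.Analysis.FluidPDE
open Summit.NavierStokesRegularity.NavierStokesRegularity.Theorems

/-- `ℝ³` (the line's `local notation "E3"`, spelled as a reducible abbreviation for the tree). -/
abbrev E3 := EuclideanSpace ℝ (Fin 3)

/-! ## A. Flat jets of analytic maps (generic) -/

section Flat

variable {E F : Type*} [NormedAddCommGroup E] [NormedSpace ℝ E] [NormedAddCommGroup F]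
  [NormedSpace ℝ F] [CompleteSpace F]

/-- **Identity principle from the jet.**  If `f` is real-analytic at `x₀` and all its derivatives of
order `≥ 1` vanish at `x₀`, then `f ≡ f(x₀)` near `x₀` (Taylor expansion of analytic maps). -/
theorem eventually_eq_of_flat_from_one {f : E → F} {x₀ : E} (hf : AnalyticAt ℝ f x₀)
    (hflat : ∀ n : ℕ, 1 ≤ n → iteratedFDeriv ℝ n f x₀ = 0) : ∀ᶠ z in 𝓝 x₀, f z = f x₀ := by
  obtain ⟨p, r, hp⟩ := hf
  have hr := hp.r_pos
  have hball : ∀ y ∈ Metric.eball (0 : E) r, f (x₀ + y) = f x₀ := fun y hy => by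
    have hs := hp.hasSum_iteratedFDeriv hy
    have hterm : ∀ n : ℕ, n ≠ 0 →
        (fun n : ℕ => ((n ! : ℝ)⁻¹) • iteratedFDeriv ℝ n f x₀ (fun _ => y)) n = 0 := fun n hn => by
      simp [hflat n (Nat.one_le_iff_ne_zero.2 hn)]
    have hs' := hasSum_single (f := fun n : ℕ => ((n ! : ℝ)⁻¹) • iteratedFDeriv ℝ n f x₀ (fun _ => y))
      0 (fun n hn => hterm n hn)
    have h0 : ((0 ! : ℝ)⁻¹) • iteratedFDeriv ℝ 0 f x₀ (fun _ => y) = f x₀ := by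
      simp [iteratedFDeriv_zero_apply]
    simp only [h0] at hs'
    exact hs.unique hs'
  have hmem : Metric.eball x₀ r ∈ 𝓝 x₀ := Metric.eball_mem_nhds x₀ hr
  filter_upwards [hmem] with z hz
  have hz' : z - x₀ ∈ Metric.eball (0 : E) r := by
    rw [Metric.mem_eball] at hz ⊢
    simpa [edist_eq_enorm_sub] using hz
  simpa using hball (z - x₀) hz'

/-- All derivatives (including order `0`) vanish at `x₀` ⇒ `f ≡ 0` near `x₀`. -/
theorem eventually_eq_zero_of_flat {f : E → F} {x₀ : E} (hf : AnalyticAt ℝ f x₀)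
    (hflat : ∀ n : ℕ, iteratedFDeriv ℝ n f x₀ = 0) : ∀ᶠ z in 𝓝 x₀, f z = 0 := by
  have h0 : f x₀ = 0 := by
    have := congrArg (fun M : ContinuousMultilinearMap ℝ (fun _ : Fin 0 => E) F => M (fun _ => x₀))
      (hflat 0)
    simpa [iteratedFDeriv_zero_apply] using this
  filter_upwards [eventually_eq_of_flat_from_one hf (fun n _ => hflat n)] with z hz
  rw [hz, h0]

end Flat

/-- One variable: a vanishing `iteratedDeriv` is a vanishing `iteratedFDeriv`. -/
theorem iteratedFDeriv_eq_zero_of_iteratedDeriv {F : Type*} [NormedAddCommGroup F] [NormedSpace ℝ F]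
    {G : ℝ → F} {t₀ : ℝ} {n : ℕ} (h : iteratedDeriv n G t₀ = 0) : iteratedFDeriv ℝ n G t₀ = 0 := by
  ext
  simp [iteratedFDeriv_apply_eq_iteratedDeriv_mul_prod, h]

/-! ## B. The instrument: jets at one point -/

/-- The space jet of `f` at `x₀` vanishes to ALL orders (order `0` included). -/
def SpaceFlat (f : E3 → E3) (x₀ : E3) : Prop := ∀ n : ℕ, iteratedFDeriv ℝ n f x₀ = 0

/-- The space jet of `f` at `x₀` is CONSTANT: all derivatives of order `≥ 1` vanish. -/
def SpaceFlatFromOne (f : E3 → E3) (x₀ : E3) : Prop :=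
  ∀ n : ℕ, 1 ≤ n → iteratedFDeriv ℝ n f x₀ = 0

/-- The space jet of `f` at `x₀` vanishes to order `N` (the ORDER-OF-VANISHING meter). -/
def FlatToOrder (f : E3 → E3) (x₀ : E3) (N : ℕ) : Prop :=
  ∀ n : ℕ, n ≤ N → iteratedFDeriv ℝ n f x₀ = 0

/-- The time curve `s ↦ u(s,x)` is STEADY TO INFINITE ORDER at `t₀`. -/
def TimeFlatFromOne (u : ℝ → E3 → E3) (t₀ : ℝ) (x : E3) : Prop :=
  ∀ n : ℕ, 1 ≤ n → iteratedDeriv n (fun s => u s x) t₀ = 0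

/-- A jet flat to all orders is flat to every finite order. -/
theorem SpaceFlat.flatToOrder {f : E3 → E3} {x₀ : E3} (h : SpaceFlat f x₀) (N : ℕ) :
    FlatToOrder f x₀ N := fun n _ => h n

/-! ## C. Space jets on the class -/

section OnClass

variable {C : ℝ} {u : ℝ → E3 → E3}

/-- **Row_A2jv engine.**  A flat vorticity jet at one point of one slice kills a class element
(slice analyticity `analyticOnNhd_slice_univ`, `analyticOnNhd_curl`; identity principle from the jet;
tree `openSetVorticityLiouville`). -/
theorem eq_zero_of_vorticity_flat (h : IsTypeIAncientMild C u) {t₀ : ℝ} (ht₀ : t₀ < 0) {x₀ : E3}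
    (hflat : SpaceFlat (curl (u t₀)) x₀) : ∀ t < 0, ∀ x, u t x = 0 := by
  have han : AnalyticOnNhd ℝ (curl (u t₀)) univ :=
    analyticOnNhd_curl (h.analyticOnNhd_slice_univ ht₀)
  have hev := eventually_eq_zero_of_flat (han x₀ (mem_univ _)) hflat
  obtain ⟨U, hUsub, hU, hx₀⟩ := _root_.mem_nhds_iff.1 hev
  exact openSetVorticityLiouville h ht₀ hU ⟨x₀, hx₀⟩ fun x hx => hUsub hx

/-- **Row_A2ju engine.**  A velocity slice constant to infinite order at one point kills a class
element (identity principle from the jet; identity theorem on the connected `ℝ³`; tree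
`sliceConstLiouville`). -/
theorem eq_zero_of_velocity_jet_const (h : IsTypeIAncientMild C u) {t₀ : ℝ} (ht₀ : t₀ < 0) {x₀ : E3}
    (hflat : SpaceFlatFromOne (u t₀) x₀) : ∀ t < 0, ∀ x, u t x = 0 := by
  have han : AnalyticOnNhd ℝ (u t₀) univ := h.analyticOnNhd_slice_univ ht₀
  have hev : ∀ᶠ z in 𝓝 x₀, u t₀ z = u t₀ x₀ :=
    eventually_eq_of_flat_from_one (han x₀ (mem_univ _)) hflat
  have hg : AnalyticOnNhd ℝ (fun z => u t₀ z - u t₀ x₀) univ := fun z hz =>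
    (han z hz).sub analyticAt_const
  have hev' : (fun z => u t₀ z - u t₀ x₀) =ᶠ[𝓝 x₀] 0 := by
    filter_upwards [hev] with z hz
    simp [hz]
  have hzero := hg.eqOn_zero_of_preconnected_of_eventuallyEq_zero isPreconnected_univ (mem_univ x₀) hev'
  exact sliceConstLiouville h ht₀ (b := u t₀ x₀) fun x => sub_eq_zero.1 (hzero (mem_univ x))

/-! ## D. Time jets on the class -/

/-- A vector bounded by `C/√(−s)` for EVERY `s < 0` is zero. -/
theorem eq_zero_of_forall_norm_le_div_sqrt {v : E3} {K : ℝ}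
    (hv : ∀ s : ℝ, s < 0 → ‖v‖ ≤ K / Real.sqrt (-s)) : v = 0 := by
  by_contra hne
  have ha : 0 < ‖v‖ := norm_pos_iff.2 hne
  have h1 := hv (-1) (by norm_num)
  rw [neg_neg, Real.sqrt_one, div_one] at h1
  have hK : 0 < K := ha.trans_le h1
  set R : ℝ := 2 * K / ‖v‖ with hR
  have hR0 : 0 < R := by positivity
  have key := hv (-(R ^ 2)) (by nlinarith)
  rw [neg_neg, Real.sqrt_sq hR0.le] at key
  have hKR : K / R = ‖v‖ / 2 := by
    rw [hR]; field_simp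
  rw [hKR] at key
  linarith

/-- **Time curves steady to infinite order are constant in time** (joint analyticity of class
elements `openSetLiouville_analyticOnNhd_uncurry`, analyticity of the time curve `curry_left`, identity
principle from the jet, identity theorem on the connected `(−∞,0)`). -/
theorem timeCurve_const_of_flat (h : IsTypeIAncientMild C u) {t₀ : ℝ} (ht₀ : t₀ < 0) {x : E3}
    (hflat : TimeFlatFromOne u t₀ x) : ∀ s < 0, u s x = u t₀ x := by
  have han := openSetLiouville_analyticOnNhd_uncurry h
  have hG : AnalyticOnNhd ℝ (fun s => u s x) (Iio 0) := fun s hs =>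
    (han (s, x) (mk_mem_prod hs (mem_univ _))).curry_left
  have hfl : ∀ n : ℕ, 1 ≤ n → iteratedFDeriv ℝ n (fun s => u s x) t₀ = 0 := fun n hn =>
    iteratedFDeriv_eq_zero_of_iteratedDeriv (hflat n hn)
  have hev : (fun s => u s x) =ᶠ[𝓝 t₀] fun _ => u t₀ x :=
    eventually_eq_of_flat_from_one (hG t₀ ht₀) hfl
  intro s hs
  exact hG.eqOn_of_preconnected_of_eventuallyEq analyticOnNhd_const isPreconnected_Iio ht₀ hev hs

/-- **Row_A2jp engine (time-jet reading).**  A point where the flow is steady to infinite order is a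
zero of the velocity: the time-constant value is bounded by `C/√(−s)` for every `s < 0`. -/
theorem eq_zero_of_timeFlat_point (h : IsTypeIAncientMild C u) {t₀ : ℝ} (ht₀ : t₀ < 0) {x : E3}
    (hflat : TimeFlatFromOne u t₀ x) : u t₀ x = 0 :=
  eq_zero_of_forall_norm_le_div_sqrt (K := C) fun s hs => by
    rw [← timeCurve_const_of_flat h ht₀ hflat s hs]; exact h.norm_le hs x

/-- **Row_A2jt engine.**  Steady to infinite order at every point of a nonempty open set of one
slice ⇒ the slice vanishes there ⇒ `u ≡ 0` (tree `openSetVelocityLiouville`). -/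
theorem eq_zero_of_timeFlat_open (h : IsTypeIAncientMild C u) {t₀ : ℝ} (ht₀ : t₀ < 0) {U : Set E3}
    (hU : IsOpen U) (hne : U.Nonempty) (hflat : ∀ x ∈ U, TimeFlatFromOne u t₀ x) :
    ∀ t < 0, ∀ x, u t x = 0 :=
  openSetVelocityLiouville h ht₀ hU hne fun x hx => eq_zero_of_timeFlat_point h ht₀ (hflat x hx)

end OnClass

/-! ## E. Rows -/

/-- Row A2jv · VORTICITY JET (PROVED): a flat vorticity jet at one point of one slice kills the element. -/
def Row_A2jv : Prop :=
  ∀ (C : ℝ) (u : ℝ → E3 → E3), IsTypeIAncientMild C u →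
    (∃ t₀ < (0 : ℝ), ∃ x₀ : E3, SpaceFlat (curl (u t₀)) x₀) → ∀ t < 0, ∀ x, u t x = 0

/-- Row A2ju · VELOCITY JET (PROVED): a velocity slice constant to infinite order at one point kills
the element. -/
def Row_A2ju : Prop :=
  ∀ (C : ℝ) (u : ℝ → E3 → E3), IsTypeIAncientMild C u →
    (∃ t₀ < (0 : ℝ), ∃ x₀ : E3, SpaceFlatFromOne (u t₀) x₀) → ∀ t < 0, ∀ x, u t x = 0

/-- Row A2jp · TIME-JET READING (PROVED, pointwise law): steady to infinite order at `(t₀,x₀)` ⇒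
`u(t₀,x₀) = 0`. -/
def Row_A2jp : Prop :=
  ∀ (C : ℝ) (u : ℝ → E3 → E3), IsTypeIAncientMild C u → ∀ t₀ < (0 : ℝ), ∀ x₀ : E3,
    TimeFlatFromOne u t₀ x₀ → u t₀ x₀ = 0

/-- Row A2jt · TIME JET ON A WINDOW (PROVED): steady to infinite order at `t₀` on a nonempty open set
⇒ `u ≡ 0`. -/
def Row_A2jt : Prop :=
  ∀ (C : ℝ) (u : ℝ → E3 → E3), IsTypeIAncientMild C u →
    (∃ t₀ < (0 : ℝ), ∃ U : Set E3, IsOpen U ∧ U.Nonempty ∧ ∀ x ∈ U, TimeFlatFromOne u t₀ x) →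
      ∀ t < 0, ∀ x, u t x = 0

/-- Row A2jN · FINITE VANISHING ORDER (OPEN, typed): for every `C` some order `N` of vanishing of the
vorticity at one point of one slice already kills the element. -/
@[conjecture] def Row_A2jN : Prop :=
  ∀ C : ℝ, ∃ N : ℕ, ∀ u : ℝ → E3 → E3, IsTypeIAncientMild C u →
    (∃ t₀ < (0 : ℝ), ∃ x₀ : E3, FlatToOrder (curl (u t₀)) x₀ N) → ∀ t < 0, ∀ x, u t x = 0

/-- Row A2jNU · UNIVERSAL VANISHING ORDER (OPEN, typed). -/
@[conjecture] def Row_A2jNU : Prop :=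
  ∃ N : ℕ, ∀ (C : ℝ) (u : ℝ → E3 → E3), IsTypeIAncientMild C u →
    (∃ t₀ < (0 : ℝ), ∃ x₀ : E3, FlatToOrder (curl (u t₀)) x₀ N) → ∀ t < 0, ∀ x, u t x = 0

/-- Row A2jT · PERMANENT STAGNATION POINT (OPEN, typed): steady to infinite order at ONE point ⇒
`u ≡ 0`. -/
@[conjecture] def Row_A2jT : Prop :=
  ∀ (C : ℝ) (u : ℝ → E3 → E3), IsTypeIAncientMild C u →
    (∃ t₀ < (0 : ℝ), ∃ x₀ : E3, TimeFlatFromOne u t₀ x₀) → ∀ t < 0, ∀ x, u t x = 0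

/-! ## F. Verdicts and nestings -/

/-- **Row A2jv holds** (vorticity jet). -/
theorem row_A2jv : Row_A2jv := fun _ _ hu ⟨_, ht₀, _, hflat⟩ => eq_zero_of_vorticity_flat hu ht₀ hflat

/-- **Row A2ju holds** (velocity jet). -/
theorem row_A2ju : Row_A2ju := fun _ _ hu ⟨_, ht₀, _, hflat⟩ =>
  eq_zero_of_velocity_jet_const hu ht₀ hflat

/-- **Row A2jp holds** (time-jet reading, pointwise law). -/
theorem row_A2jp : Row_A2jp := fun _ _ hu _ ht₀ _ hflat => eq_zero_of_timeFlat_point hu ht₀ hflat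

/-- **Row A2jt holds** (time jet on a window). -/
theorem row_A2jt : Row_A2jt := fun _ _ hu ⟨_, ht₀, _, hU, hne, hflat⟩ =>
  eq_zero_of_timeFlat_open hu ht₀ hU hne hflat

/-- Nesting: a universal order gives a `C`-dependent one. -/
theorem row_A2jNU_imp_A2jN : Row_A2jNU → Row_A2jN := fun ⟨N, h⟩ C => ⟨N, fun u hu hx => h C u hu hx⟩

/-- Nesting: a finite vanishing order suffices ⇒ the infinite order suffices. -/
theorem row_A2jN_imp_A2jv : Row_A2jN → Row_A2jv := fun h C u hu ⟨t₀, ht₀, x₀, hflat⟩ => by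
  obtain ⟨N, hN⟩ := h C
  exact hN u hu ⟨t₀, ht₀, x₀, hflat.flatToOrder N⟩

/-- Nesting: one permanent stagnation point suffices ⇒ an open window of them suffices. -/
theorem row_A2jT_imp_A2jt : Row_A2jT → Row_A2jt := fun h C u hu ⟨t₀, ht₀, _, _, ⟨x₀, hx₀⟩, hflat⟩ =>
  h C u hu ⟨t₀, ht₀, x₀, hflat x₀ hx₀⟩

/-- (L′) decides every cell (informational). -/
theorem rows_of_L' (hL : ∀ (C : ℝ) (u : ℝ → E3 → E3), IsTypeIAncientMild C u → ∀ t < 0, ∀ x, u t x = 0) :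
    Row_A2jN ∧ Row_A2jNU ∧ Row_A2jT :=
  ⟨fun C => ⟨0, fun u hu _ => hL C u hu⟩, ⟨0, fun C u hu _ => hL C u hu⟩, fun C u hu _ => hL C u hu⟩

end Summit.NavierStokesRegularity.NavierStokesRegularity.Theorems.ScenarioCensus.JetMeter

namespace Summit.NavierStokesRegularity.NavierStokesRegularity.Theorems.ScenarioCensus

/-! ## Census KEYS (ns `…Theorems.ScenarioCensus`): instrument JET METER (block A2) — TREE-decided cells A2jv / A2ju / A2jp / A2jt, OPEN rows A2jN / A2jNU / A2jT -/

/-- **Cell A2jv** (VORTICITY JET: `curl u(t₀,·)` flat to infinite order at one point of one slice ⇒ `u ≡ 0`): `:= JetMeter.Row_A2jv`. DECIDED. -/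
def Row_A2jv : Prop := JetMeter.Row_A2jv
/-- A2jv is EXCLUDED (decided in the tree): `JetMeter.row_A2jv`. -/
theorem row_A2jv_excluded : Row_A2jv := JetMeter.row_A2jv

/-- **Cell A2ju** (VELOCITY JET: `u(t₀,·)` constant to infinite order at one point ⇒ `u ≡ 0`): `:= JetMeter.Row_A2ju`. DECIDED. -/
def Row_A2ju : Prop := JetMeter.Row_A2ju
/-- A2ju is EXCLUDED (decided in the tree): `JetMeter.row_A2ju`. -/
theorem row_A2ju_excluded : Row_A2ju := JetMeter.row_A2ju

/-- **Cell A2jp** (TIME-JET READING, pointwise law: steady to infinite order at `(t₀,x₀)` ⇒ `u(t₀,x₀) = 0`): `:= JetMeter.Row_A2jp`. DECIDED. -/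
def Row_A2jp : Prop := JetMeter.Row_A2jp
/-- A2jp is EXCLUDED (decided in the tree): `JetMeter.row_A2jp`. -/
theorem row_A2jp_excluded : Row_A2jp := JetMeter.row_A2jp

/-- **Cell A2jt** (TIME JET on a window: steady to infinite order at `t₀` on a nonempty open set ⇒ `u ≡ 0`): `:= JetMeter.Row_A2jt`. DECIDED. -/
def Row_A2jt : Prop := JetMeter.Row_A2jt
/-- A2jt is EXCLUDED (decided in the tree): `JetMeter.row_A2jt`. -/
theorem row_A2jt_excluded : Row_A2jt := JetMeter.row_A2jt

/-- **Row A2jN** (FINITE vanishing order, `C`-dependent) — typed only: `:= JetMeter.Row_A2jN`. OPEN (no witness, no proof). -/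
@[conjecture] def Row_A2jN : Prop := JetMeter.Row_A2jN

/-- **Row A2jNU** (UNIVERSAL vanishing order) — typed only: `:= JetMeter.Row_A2jNU`. OPEN (no witness, no proof). -/
@[conjecture] def Row_A2jNU : Prop := JetMeter.Row_A2jNU

/-- **Row A2jT** (PERMANENT STAGNATION POINT) — typed only: `:= JetMeter.Row_A2jT`. OPEN (no witness, no proof). -/
@[conjecture] def Row_A2jT : Prop := JetMeter.Row_A2jT

/-- Lattice edges at key level: A2jNU → A2jN → A2jv, A2jT → A2jt (`JetMeter.row_A2jNU_imp_A2jN` / `row_A2jN_imp_A2jv` / `row_A2jT_imp_A2jt`). -/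
theorem row_A2jN_of_row_A2jNU : Row_A2jNU → Row_A2jN := JetMeter.row_A2jNU_imp_A2jN
/-- See `row_A2jN_of_row_A2jNU`. -/
theorem row_A2jv_of_row_A2jN : Row_A2jN → Row_A2jv := JetMeter.row_A2jN_imp_A2jv
/-- See `row_A2jN_of_row_A2jNU`. -/
theorem row_A2jt_of_row_A2jT : Row_A2jT → Row_A2jt := JetMeter.row_A2jT_imp_A2jt

end Summit.NavierStokesRegularity.NavierStokesRegularity.Theorems.ScenarioCensus

end
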